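import Summits.Ventures.HodgeRepro2.T5SU11KernelUniformBounds
import Summits.Ventures.HodgeRepro2.T5SU11KernelCompositionSign

/-!
# The composed kernels are Lipschitz in the spectral parameter, uniformly in `(t, s)` away from the corner

Row 579 gives `∂_λ K_λ^{∘(n+1)}(t, s) = (2λ − 2)(n + 1) K_λ^{∘(n+2)}(t, s)` and row 592 that `|K_λ^{∘(n+1)}(t, s)| = (−1)^{n+1} K_λ^{∘(n+1)}(t, s)`
DEcreases with `λ` (`(−1)ⁿ K^{∘(n+1)}` increases). The mean value theorem in `λ` therefore bounds the increment by the
derivative at the SMALLER parameter: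

* `abs_kernel_comp_antitone` — **`1 < λ₀ ≤ λ ⇒ |K_λ^{∘(n+1)}(t, s)| ≤ |K_{λ₀}^{∘(n+1)}(t, s)|`**;
* `abs_kernel_comp_sub_le` — **`|K_λ^{∘(n+1)}(t, s) − K_{λ₂}^{∘(n+1)}(t, s)| ≤ |λ − λ₂| · 2(max(λ, λ₂) − 1)(n + 1) |K_{min(λ, λ₂)}^{∘(n+2)}(t, s)|`**
  for all `t, s > 0` (pointwise, no restriction);
* `exists_abs_kernel_comp_sub_le_uniform` — **the Lipschitz bound uniformly in `(t, s)` on `{max(t, s) ≥ a}` and in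
  `λ, λ₂ ≥ λ₁ > 1`: `… ≤ |λ − λ₂| · 2(max(λ, λ₂) − 1)(n + 1) C Ξ(s) Ξ(t)`**, `C = C(λ₁, a, n)`;
* `tendstoUniformlyOn_kernel_comp_nhds` — **`λ ↦ K_λ^{∘(n+1)}(t, s)` is continuous at every `λ₂ > 1` uniformly in `(t, s)` on
  `{max(t, s) ≥ a}`**.

Nothing is claimed about (N).

Blind lane: Mathlib + the HodgeRepro2 prefix only; no sorry; axioms ⊆ {propext, Classical.choice,
Quot.sound}.
-/

namespace Summit.Ventures.HodgeRepro2.T5SU11KernelCompositionLipschitzUniform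

open Filter Topology MeasureTheory
open Set (Ioi Ioc Ioo Icc)
open T5SU11Cartan T5SU11SphericalFunction T5SU11SphericalBounds T5SU11SphericalDecay T5SU11RadialGreenKernel
  T5SU11RadialGreenImproper T5SU11KernelCompositionDerivative T5SU11KernelCompositionSign T5SU11KernelUniformBounds

section measure

variable [MeasurableSpace Circle] [BorelSpace Circle]

variable {s : ℝ} (hs : 0 < s)

include hs in
/-- **`|K_λ^{∘(n+1)}(t, s)|` decreases with `λ`**: `1 < λ₀ ≤ λ ⇒ |K_λ^{∘(n+1)}(t, s)| ≤ |K_{λ₀}^{∘(n+1)}(t, s)|` (row 592). -/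
theorem abs_kernel_comp_antitone {lam₀ lam : ℝ} (hlam₀ : 1 < lam₀) (hle : lam₀ ≤ lam) (n : ℕ) {t : ℝ} (ht : 0 < t) :
    |((greenSolI (fun t => sph lam (hyp t)) (sphDecay lam))^[n] (fun r => sphGreenKernel lam r s)) t|
      ≤ |((greenSolI (fun t => sph lam₀ (hyp t)) (sphDecay lam₀))^[n] (fun r => sphGreenKernel lam₀ r s)) t| := by
  have hlam : 1 < lam := lt_of_lt_of_le hlam₀ hle
  rw [abs_kernel_comp_eq hlam n ht, abs_kernel_comp_eq hlam₀ n ht]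
  have hmono := kernel_comp_sign_monotoneOn_lam hs n ht (show lam₀ ∈ Ioi (1 : ℝ) from hlam₀)
    (show lam ∈ Ioi (1 : ℝ) from hlam) hle
  simp only at hmono
  have e : (-1 : ℝ) ^ (n + 1) = -((-1 : ℝ) ^ n) := by
    rw [pow_succ]
    ring
  rw [e, neg_mul, neg_mul]
  linarith

include hs in
/-- **THE MEAN VALUE BOUND FOR THE COMPOSED KERNELS IN `λ`**:
`|K_λ^{∘(n+1)}(t, s) − K_{λ₂}^{∘(n+1)}(t, s)| ≤ |λ − λ₂| · 2(max(λ, λ₂) − 1)(n + 1) |K_{min(λ, λ₂)}^{∘(n+2)}(t, s)|` for `λ, λ₂ > 1`, `t > 0`. -/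
theorem abs_kernel_comp_sub_le {lam lam₂ : ℝ} (hlam : 1 < lam) (hlam₂ : 1 < lam₂) (n : ℕ) {t : ℝ} (ht : 0 < t) :
    |((greenSolI (fun t => sph lam (hyp t)) (sphDecay lam))^[n] (fun r => sphGreenKernel lam r s)) t
        - ((greenSolI (fun t => sph lam₂ (hyp t)) (sphDecay lam₂))^[n] (fun r => sphGreenKernel lam₂ r s)) t|
      ≤ |lam - lam₂| * (2 * (max lam lam₂ - 1) * (n + 1)
        * |((greenSolI (fun t => sph (min lam lam₂) (hyp t)) (sphDecay (min lam lam₂)))^[n + 1]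
          (fun r => sphGreenKernel (min lam lam₂) r s)) t|) := by
  -- the mean value bound for `a < b`, both `> 1`
  have key : ∀ a b : ℝ, 1 < a → a < b →
      |((greenSolI (fun t => sph b (hyp t)) (sphDecay b))^[n] (fun r => sphGreenKernel b r s)) t
          - ((greenSolI (fun t => sph a (hyp t)) (sphDecay a))^[n] (fun r => sphGreenKernel a r s)) t|
        ≤ |b - a| * (2 * (b - 1) * (n + 1)
          * |((greenSolI (fun t => sph a (hyp t)) (sphDecay a))^[n + 1] (fun r => sphGreenKernel a r s)) t|) := by
    intro a b ha hab
    have hcont : ContinuousOn (fun l => ((greenSolI (fun t => sph l (hyp t)) (sphDecay l))^[n]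
        (fun r => sphGreenKernel l r s)) t) (Icc a b) := by
      intro l hl
      have hl1 : 1 < l := lt_of_lt_of_le ha hl.1
      exact (hasDerivAt_kernel_comp_lam hl1 hs n ht).continuousAt.continuousWithinAt
    have hderiv : ∀ l ∈ Ioo a b, HasDerivAt (fun l => ((greenSolI (fun t => sph l (hyp t)) (sphDecay l))^[n]
        (fun r => sphGreenKernel l r s)) t)
        ((2 * l - 2) * ((n + 1 : ℕ) * ((greenSolI (fun t => sph l (hyp t)) (sphDecay l))^[n + 1]
          (fun r => sphGreenKernel l r s)) t)) l := by
      intro l hl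
      have hl1 : 1 < l := lt_trans ha hl.1
      exact hasDerivAt_kernel_comp_lam hl1 hs n ht
    obtain ⟨c, hc, hslope⟩ := exists_hasDerivAt_eq_slope _ _ hab hcont hderiv
    have hc1 : 1 < c := lt_trans ha hc.1
    have hba : 0 < b - a := sub_pos.mpr hab
    -- `f b − f a = (b − a) f′(c)`
    have hdiff : ((greenSolI (fun t => sph b (hyp t)) (sphDecay b))^[n] (fun r => sphGreenKernel b r s)) t
        - ((greenSolI (fun t => sph a (hyp t)) (sphDecay a))^[n] (fun r => sphGreenKernel a r s)) t
        = (b - a) * ((2 * c - 2) * ((n + 1 : ℕ) * ((greenSolI (fun t => sph c (hyp t)) (sphDecay c))^[n + 1]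
          (fun r => sphGreenKernel c r s)) t)) := by
      rw [hslope]
      field_simp
    rw [hdiff, abs_mul, abs_mul, abs_mul, abs_of_pos hba, abs_of_pos (by linarith : (0 : ℝ) < 2 * c - 2),
      abs_of_pos (Nat.cast_pos.mpr (Nat.succ_pos n) : (0 : ℝ) < (n + 1 : ℕ))]
    have hK := abs_kernel_comp_antitone hs ha hc.1.le (n + 1) ht
    have h2c : 2 * c - 2 ≤ 2 * (b - 1) := by linarith [hc.2]
    have hn : ((n + 1 : ℕ) : ℝ) = (n + 1 : ℝ) := by push_cast; ring
    rw [hn]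
    apply mul_le_mul_of_nonneg_left _ hba.le
    calc (2 * c - 2) * ((n + 1 : ℝ)
          * |((greenSolI (fun t => sph c (hyp t)) (sphDecay c))^[n + 1] (fun r => sphGreenKernel c r s)) t|)
        ≤ (2 * (b - 1)) * ((n + 1 : ℝ)
          * |((greenSolI (fun t => sph a (hyp t)) (sphDecay a))^[n + 1] (fun r => sphGreenKernel a r s)) t|) := by
          apply mul_le_mul h2c (mul_le_mul_of_nonneg_left hK (by positivity)) (by positivity) (by linarith)
      _ = 2 * (b - 1) * (n + 1)
          * |((greenSolI (fun t => sph a (hyp t)) (sphDecay a))^[n + 1] (fun r => sphGreenKernel a r s)) t| := by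
          ring
  rcases lt_trichotomy lam lam₂ with hlt | heq | hgt
  · rw [min_eq_left hlt.le, max_eq_right hlt.le, abs_sub_comm]
    have := key lam lam₂ hlam hlt
    rwa [abs_sub_comm lam₂ lam] at this
  · subst heq
    simp
  · rw [min_eq_right hgt.le, max_eq_left hgt.le]
    exact key lam₂ lam hlam₂ hgt

include hs in
/-- **THE LIPSCHITZ BOUND UNIFORMLY IN `(t, s)` AWAY FROM THE CORNER AND IN `λ, λ₂ ≥ λ₁`**: there is `C = C(λ₁, a, n) > 0` with
`|K_λ^{∘(n+1)}(t, s) − K_{λ₂}^{∘(n+1)}(t, s)| ≤ |λ − λ₂| · 2(max(λ, λ₂) − 1)(n + 1) C Ξ(s) Ξ(t)` for all `λ, λ₂ ≥ λ₁ > 1` and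
`t, s > 0` with `max(t, s) ≥ a`. -/
theorem exists_abs_kernel_comp_sub_le_uniform {lam₁ : ℝ} (hlam₁ : 1 < lam₁) {a : ℝ} (ha : 0 < a) (n : ℕ) :
    ∃ C : ℝ, 0 < C ∧ ∀ lam lam₂, lam₁ ≤ lam → lam₁ ≤ lam₂ → ∀ t, 0 < t → a ≤ max t s →
      |((greenSolI (fun t => sph lam (hyp t)) (sphDecay lam))^[n] (fun r => sphGreenKernel lam r s)) t
          - ((greenSolI (fun t => sph lam₂ (hyp t)) (sphDecay lam₂))^[n] (fun r => sphGreenKernel lam₂ r s)) t|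
        ≤ |lam - lam₂| * (2 * (max lam lam₂ - 1) * (n + 1) * (C * sph 1 (hyp s) * sph 1 (hyp t))) := by
  obtain ⟨C, hC, hC'⟩ := exists_kernel_comp_le_uniform_of_le_max hlam₁ ha
  have hr : 0 < (lam₁ - 1) ^ 2 := by
    have : 0 < lam₁ - 1 := by linarith
    positivity
  refine ⟨C / ((lam₁ - 1) ^ 2) ^ (n + 1), by positivity, fun lam lam₂ hl hl₂ t ht hm => ?_⟩
  have hlam : 1 < lam := lt_of_lt_of_le hlam₁ hl
  have hlam₂ : 1 < lam₂ := lt_of_lt_of_le hlam₁ hl₂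
  refine (abs_kernel_comp_sub_le hs hlam hlam₂ n ht).trans ?_
  apply mul_le_mul_of_nonneg_left _ (abs_nonneg _)
  have hmax1 : 0 ≤ max lam lam₂ - 1 := by linarith [le_max_left lam lam₂]
  apply mul_le_mul_of_nonneg_left _ (mul_nonneg (mul_nonneg two_pos.le hmax1) (by positivity))
  -- `|K_{min}^{∘(n+2)}| ≤ |K_{λ₁}^{∘(n+2)}| ≤ C Ξ(s) Ξ(t)/((λ₁ − 1)²)^{n+1}`
  have hmin : lam₁ ≤ min lam lam₂ := le_min hl hl₂
  calc |((greenSolI (fun t => sph (min lam lam₂) (hyp t)) (sphDecay (min lam lam₂)))^[n + 1]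
          (fun r => sphGreenKernel (min lam lam₂) r s)) t|
      ≤ |((greenSolI (fun t => sph lam₁ (hyp t)) (sphDecay lam₁))^[n + 1] (fun r => sphGreenKernel lam₁ r s)) t| :=
        abs_kernel_comp_antitone hs hlam₁ hmin (n + 1) ht
    _ ≤ C * sph 1 (hyp s) * sph 1 (hyp t) / ((lam₁ - 1) ^ 2) ^ (n + 1) := hC' (n + 1) t s ht hs hm
    _ = C / ((lam₁ - 1) ^ 2) ^ (n + 1) * sph 1 (hyp s) * sph 1 (hyp t) := by ring

/-- **`λ ↦ K_λ^{∘(n+1)}(t, s)` IS CONTINUOUS AT `λ₂` UNIFORMLY IN `(t, s)` ON `{max(t, s) ≥ a}`**. -/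
theorem tendstoUniformlyOn_kernel_comp_nhds {lam₂ : ℝ} (hlam₂ : 1 < lam₂) {a : ℝ} (ha : 0 < a) (n : ℕ) :
    TendstoUniformlyOn
      (fun lam (p : ℝ × ℝ) => ((greenSolI (fun t => sph lam (hyp t)) (sphDecay lam))^[n]
        (fun r => sphGreenKernel lam r p.2)) p.1)
      (fun p => ((greenSolI (fun t => sph lam₂ (hyp t)) (sphDecay lam₂))^[n] (fun r => sphGreenKernel lam₂ r p.2)) p.1)
      (𝓝 lam₂) {p : ℝ × ℝ | 0 < p.1 ∧ 0 < p.2 ∧ a ≤ max p.1 p.2} := by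
  -- the uniform constant at `λ₁ = (1 + λ₂)/2`
  have hlam₁ : 1 < (1 + lam₂) / 2 := by linarith
  obtain ⟨C, hC, hC'⟩ := exists_kernel_comp_le_uniform_of_le_max hlam₁ ha
  have hr : 0 < (((1 + lam₂) / 2 - 1) ^ 2) ^ (n + 1) := by
    have : 0 < (1 + lam₂) / 2 - 1 := by linarith
    positivity
  rw [Metric.tendstoUniformlyOn_iff]
  intro ε hε
  -- the bound `|λ − λ₂| · 2 λ₂ (n + 1) C/((λ₁ − 1)²)^{n+1}` tends to `0`
  set M : ℝ := 2 * lam₂ * (n + 1) * (C / (((1 + lam₂) / 2 - 1) ^ 2) ^ (n + 1)) with hM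
  have hM0 : 0 < M := by positivity
  have hB : Tendsto (fun lam : ℝ => |lam - lam₂| * M) (𝓝 lam₂) (𝓝 0) := by
    have h : Tendsto (fun lam : ℝ => lam - lam₂) (𝓝 lam₂) (𝓝 (lam₂ - lam₂)) :=
      (continuous_id.sub continuous_const).tendsto lam₂
    rw [sub_self] at h
    simpa using h.abs.mul_const M
  have hev := (tendsto_order.1 hB).2 ε hε
  have hev₁ : ∀ᶠ lam in 𝓝 lam₂, (1 + lam₂) / 2 < lam := lt_mem_nhds (by linarith)
  have hev₂ : ∀ᶠ lam in 𝓝 lam₂, lam < lam₂ + 1 := gt_mem_nhds (by linarith)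
  filter_upwards [hev, hev₁, hev₂] with lam hlam' hl₁ hl₂
  rintro ⟨t, s⟩ ⟨ht, hs, hm⟩
  rw [Real.dist_eq, abs_sub_comm]
  refine lt_of_le_of_lt ?_ hlam'
  have hlam : 1 < lam := lt_trans hlam₁ hl₁
  refine (abs_kernel_comp_sub_le hs hlam hlam₂ n ht).trans ?_
  apply mul_le_mul_of_nonneg_left _ (abs_nonneg _)
  have hmin : (1 + lam₂) / 2 ≤ min lam lam₂ := le_min hl₁.le (by linarith)
  have hΞt : sph 1 (hyp t) ≤ 1 := sph_hyp_le_one zero_le_one one_le_two t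
  have hΞs : sph 1 (hyp s) ≤ 1 := sph_hyp_le_one zero_le_one one_le_two s
  have hΞt0 : 0 < sph 1 (hyp t) := sph_hyp_pos 1 t
  have hmax : 2 * (max lam lam₂ - 1) ≤ 2 * lam₂ := by
    have : max lam lam₂ ≤ lam₂ + 1 := max_le hl₂.le (by linarith)
    linarith
  have hK : |((greenSolI (fun t => sph (min lam lam₂) (hyp t)) (sphDecay (min lam lam₂)))^[n + 1]
        (fun r => sphGreenKernel (min lam lam₂) r s)) t| ≤ C / (((1 + lam₂) / 2 - 1) ^ 2) ^ (n + 1) := by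
    calc |((greenSolI (fun t => sph (min lam lam₂) (hyp t)) (sphDecay (min lam lam₂)))^[n + 1]
            (fun r => sphGreenKernel (min lam lam₂) r s)) t|
        ≤ |((greenSolI (fun t => sph ((1 + lam₂) / 2) (hyp t)) (sphDecay ((1 + lam₂) / 2)))^[n + 1]
            (fun r => sphGreenKernel ((1 + lam₂) / 2) r s)) t| := abs_kernel_comp_antitone hs hlam₁ hmin (n + 1) ht
      _ ≤ C * sph 1 (hyp s) * sph 1 (hyp t) / (((1 + lam₂) / 2 - 1) ^ 2) ^ (n + 1) := hC' (n + 1) t s ht hs hm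
      _ ≤ C * 1 * 1 / (((1 + lam₂) / 2 - 1) ^ 2) ^ (n + 1) := by
          apply div_le_div_of_nonneg_right _ hr.le
          exact mul_le_mul (mul_le_mul_of_nonneg_left hΞs hC.le) hΞt hΞt0.le (by positivity)
      _ = C / (((1 + lam₂) / 2 - 1) ^ 2) ^ (n + 1) := by ring
  calc 2 * (max lam lam₂ - 1) * (n + 1)
        * |((greenSolI (fun t => sph (min lam lam₂) (hyp t)) (sphDecay (min lam lam₂)))^[n + 1]
          (fun r => sphGreenKernel (min lam lam₂) r s)) t|
      ≤ 2 * lam₂ * (n + 1) * (C / (((1 + lam₂) / 2 - 1) ^ 2) ^ (n + 1)) := by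
        apply mul_le_mul (mul_le_mul_of_nonneg_right hmax (by positivity)) hK (abs_nonneg _) (by positivity)
    _ = M := rfl

end measure

end Summit.Ventures.HodgeRepro2.T5SU11KernelCompositionLipschitzUniform
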